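import Summits.QuantumFields.YangMills.Theorems.UV3BranchExpansionSocketWeights
import Summits.QuantumFields.YangMills.Theorems.BalabanUVNodesN08HaarCompatibilityGuardCoreLawSUNExplicitSlot
import Summits.QuantumFields.YangMills.Theorems.BalabanUVNodesN08HaarCompatibilityGuardCoreLawSU2
import Summits.QuantumFields.YangMills.Theorems.BalabanUVNodesN08HaarCompatibilityGuardCoreLawSU2Wide
import Summits.QuantumFields.YangMills.Theorems.BalabanUVNodesN08HaarCompatibilityGuardCoreLawSU2Record
import HarnessLib

/-!
# R3 (cell `ym3-torus`, YM₃ on T³ — a ladder RUNG, NOT d = 4, NOT infinite volume, NOT a mass gap, NOT the Clay problem) —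
# **(hw-DISCHARGE) THE WEIGHT BINDER OF THE BRANCH-EXPANSION SOCKET FROM A LEVEL-UNIFORM (H_K) LETTER AND THE ADMITTING BOUND: `w s = (K·q)^{|s|}`,
# `q = h(δ + δ′)^{L^{d−1}−1} ∕ h(δ′)`; HYPOTHESIS-FREE at print's `SU(2)` average on `L^{d−1} ≤ 9` (the T³ families at `L = 3`) and at `SU(N)` on `|Idx| ≤ 300`**

Width seat `ym-ust-19936-w8` g12 on crux `stmt-QuantumFields-19936` `UnitScaleTilt.HistoryTailL` (`--supports`, helper; THEOREMS ONLY, 0 `def`, 0 `sorry`).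
Sequel of ✓`UV3BranchExpansionSocketWeights` (p761143): its two numeric inputs are discharged BY NAME.  The per-level admitting bound ⟸ n08-w3 part 19
✓`…GuardAdmitting.measure_forall_guardAdmitting_le` (`h(δ′)^{|S|}·dU(Adm_S) ≤ h(δ+δ′)^{|S|(L^{d−1}−1)}`, divided by `h(δ′)^{|S|}` for `h(δ′) ≠ 0`; any group, any `ℰ`);
(H_K) enters as ONE level-uniform letter `hfib` (§2), discharged (§4) at print's exp-mean-log average `expMeanLogSU`: on `SU(2)` for `L^{d−1} ≤ 9` — the T³ families at
`L = 3` — by n08-w3 ✓`…GuardCoreLawSU2.fibre_law_le_su2` ∘ ✓`card_not_central_div_le` (`K = m⋆⁻¹ + 1`), for `L^{d−1} ≤ 25` by ✓`…SU2Wide.fibre_law_le_su2_wide`, and on `SU(N)` for loop-index sets `|Idx| ≤ 300` by n08-w6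
✓`…GuardCoreLawSUNExplicitSlot.fibre_law_le_explicit` (`K_N = ((1∕|Idx|)^{N²−1})⁻¹ + 1`; NOT the T³ families, whose `|Idx| = L^d·(d!)² = 36L³` — px13 g14's count,
lit `card_idx`).  `δ′` stays free (px13 g14 FINDING #60: the kernel-certifiable optimum is near `δ′ = 1∕21`, not `1∕3`).
RECORD CURRENCY (★★OWNER WORDS 84 (2) ∕ 85 (4) ∕ ACK 145): record-independent kinematics of product Haar and print's guarded averaging; SUPPLY-side for the hTop-class
rows `fibre55Win` ∕ `fibre57LowOn` of the χ record inside NODE O B3 and for Track A's N08 — NOT a 19936 registry row.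

CONTENTS.  §1 `admitting_le_pow_div` (the admitting bound as `≤ q^{|S|}`).  §2 ★★★ `hw_of_fibre_law` (the socket's `hw` at `ν := dU_{j+n}`, `w s := (K·q)^{|s|}` from ONE
level-uniform (H_K) letter; any group, any `ℰ`).  §3 finiteness letters for the assembler's `ofReal` bridge
(`window_ratio_ne_top`, `toReal_window_ratio`, `one_le_kstar_…_and_ne_top` ×3, `weight_base_ne_top`, `weight_pow_eq_ofReal`).  §4 ★★★ `hw_su2_of_pow_le_nine` (`SU(2)`, `L^{d−1} ≤ 9`, no (H_K) hypothesis) · ★★ `hw_su2_of_pow_le_twentyfive` (`SU(2)`, `L^{d−1} ≤ 25`) · ★★ `hw_su2_of_pow_le_four_hundred`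
(`SU(2)`, `L^{d−1} ≤ 400`, dag-n08-d's record (H_K)) · `hw_expMeanLogSU` (`SU(N)`, `|Idx| ≤ 300`).

HYP-SAT (★★OWNER RULING №42, read on the LITERAL T³ families `avT3 = blockAvg expMeanLogSU`, `d = 3`): `hV0`∕`hVs` are the socket's trajectory letters (definitional —
the caller's `V` is built to satisfy them, LEAD ✓`exists_global_traj`); `hn : j + n ≤ m + K` is the segment's standing range (caller's index bookkeeping); `hh0 : h(δ′) ≠ 0`
holds for every `δ′ > 0` (✓`…GuardHaarBallLower.haar_dist1_lt_ge` on `δ′ ≤ 1`), `δ′` chosen by the assembler (px13 g14: near `1∕21`); the RANGE letters are the real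
content: `hL : L^{d−1} ≤ 9 ∕ 25 ∕ 400` ⟺ `L ≤ 3 ∕ 5 ∕ 20` at `d = 3` — so §4 supplies the socket's `hw` HYPOTHESIS-FREE for the T³ members with `L ≤ 20` ONLY (three explicit
`K`'s); `HistoryTailL` quantifies EVERY `L`: for `L ≥ 21` §2 still needs an explicit level-uniform (H_K) constant, which the tree has only existentially (n08 g5
✓`…GuardCoreLawSUN`) — NOT supplied here, said so.  `hw_expMeanLogSU`'s `hI : |Idx P| ≤ 300` is EMPTY on T³ (`|Idx P| = 36L³`): a theorem of record, NOT a supply path.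

HONEST SCOPE.  Bookkeeping over ✓p761143, ✓`fibre_law_le_su2(_wide∕_record)` ∕ ✓`card_not_central_div_le(_wide∕_record)` ∕ ✓`mstar(_wide∕_record)_pos`,
✓`fibre_law_le_explicit`, ✓`measure_forall_guardAdmitting_le` BY NAME;
the smallness `K·q·(…) < 1` that (C′) needs is a NUMBER, not here; nothing of hTop ∕ (T8) ∕ (O‴χₛ) ∕ `HistoryTailL` (19936) ∕ the rung ∕ d = 4 ∕ a mass gap ∕ Clay is proved.  YM₃ on T³ is rung R3 of the ladder, not the Clay problem.

References: T. Bałaban, Commun. Math. Phys. **109** (1987) 249–301 [Balaban1987RG1] ((0.4) p. 253); T. Bałaban, Commun. Math. Phys. **102** (1985) 255–275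
[Balaban1985UV3] ((2) p. 256).
-/

set_option autoImplicit false

noncomputable section

open MeasureTheory Set Function
open scoped ENNReal

namespace Summit.QuantumFields.YangMills.Theorems.UV3BranchExpansionSocketWeightsSU

open Literature.MathematicalPhysics.QuantumFieldTheory.Balaban1983to89
open Literature.MathematicalPhysics.QuantumFieldTheory.Balaban1983to89.AveragingRT (axialAvg)
open Literature.MathematicalPhysics.QuantumFieldTheory.Balaban1983to89.BlockAveraging (Idx Small avgFun)
open Literature.MathematicalPhysics.QuantumFieldTheory.Balaban1983to89.BlockAveragingHaarAC (centralBond)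
open Literature.MathematicalPhysics.QuantumFieldTheory.Balaban1983to89.ExpMeanLog (expMeanLogSU expMeanLogSU_δ measurable_expMeanLogSU_E)
open Summit.QuantumFields.YangMills.BalabanUVNodes.N08HaarCompatibilityGuardAdmitting (measure_forall_guardAdmitting_le)
open Summit.QuantumFields.YangMills.BalabanUVNodes.N08HaarCompatibilityGuardCoreLawSUNExplicitSlot (fibre_law_le_explicit)
open Summit.QuantumFields.YangMills.BalabanUVNodes.N08HaarCompatibilityGuardCoreLawSU2 (fibre_law_le_su2 card_not_central_div_le mstar_pos)
open Summit.QuantumFields.YangMills.BalabanUVNodes.N08HaarCompatibilityGuardCoreLawSU2Wide (fibre_law_le_su2_wide card_not_central_div_le_wide mstar_wide_pos)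
open Summit.QuantumFields.YangMills.BalabanUVNodes.N08HaarCompatibilityGuardCoreLawSU2Record (fibre_law_le_su2_record card_not_central_div_le_record mstar_record_pos)
open Summit.QuantumFields.YangMills.Theorems.UV3BranchExpansionSocketWeights (hw_of_stackedActivity)

variable {N : ℕ} [NeZero N] {P : Params} {j : ℕ}

/-! ## §1 The admitting bound as a power -/

/-- **THE ADMITTING BOUND AS A POWER**: `dU(Adm_S) ≤ (h(δ+δ′)^{L^{d−1}−1} ∕ h(δ′))^{|S|}` for any small-loop average `ℰ` (radius `δ`) on any group, provided `h(δ′) ≠ 0`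
(n08-w3 part 19 ✓`measure_forall_guardAdmitting_le`, divided). [cite: Balaban1987RG1, (0.4) p.253] -/
theorem admitting_le_pow_div {G : Type*} [GaugeGroup G] [MeasurableSpace G] [RegularGaugeGroup G] [HaarData G] (ℰ : LoopAverage G)
    (hj : j + 1 ≤ P.m + P.K) (δ' : ℝ) (hh0 : (HaarData.haar : Measure G) {g : G | dist1 g < δ'} ≠ 0) (S : Finset (PBond P (j + 1))) :
    fieldMeasure P j G {U : GaugeField P j G | ∀ c ∈ S, ∃ g : G, Small ℰ (update U (centralBond c) g) c} ≤
      ((HaarData.haar : Measure G) {g : G | dist1 g < ℰ.δ + δ'} ^ (P.L ^ (P.d - 1) - 1) / (HaarData.haar : Measure G) {g : G | dist1 g < δ'}) ^ S.card := by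
  haveI := HaarData.isProb (G := G)
  have h := measure_forall_guardAdmitting_le ℰ hj δ' S
  have hhtop : (HaarData.haar : Measure G) {g : G | dist1 g < δ'} ≠ ∞ := measure_ne_top _ _
  have hpow0 : (HaarData.haar : Measure G) {g : G | dist1 g < δ'} ^ S.card ≠ 0 := pow_ne_zero _ hh0
  have hpowtop : (HaarData.haar : Measure G) {g : G | dist1 g < δ'} ^ S.card ≠ ∞ := ENNReal.pow_ne_top hhtop
  have h' : fieldMeasure P j G {U : GaugeField P j G | ∀ c ∈ S, ∃ g : G, Small ℰ (update U (centralBond c) g) c} *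
      (HaarData.haar : Measure G) {g : G | dist1 g < δ'} ^ S.card ≤
        ((HaarData.haar : Measure G) {g : G | dist1 g < ℰ.δ + δ'} ^ (P.L ^ (P.d - 1) - 1)) ^ S.card :=
    calc fieldMeasure P j G {U : GaugeField P j G | ∀ c ∈ S, ∃ g : G, Small ℰ (update U (centralBond c) g) c} *
          (HaarData.haar : Measure G) {g : G | dist1 g < δ'} ^ S.card
        = (HaarData.haar : Measure G) {g : G | dist1 g < δ'} ^ S.card *
            fieldMeasure P j G {U : GaugeField P j G | ∀ c ∈ S, ∃ g : G, Small ℰ (update U (centralBond c) g) c} := mul_comm _ _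
      _ ≤ (HaarData.haar : Measure G) {g : G | dist1 g < ℰ.δ + δ'} ^ (S.card * (P.L ^ (P.d - 1) - 1)) := h
      _ = ((HaarData.haar : Measure G) {g : G | dist1 g < ℰ.δ + δ'} ^ (P.L ^ (P.d - 1) - 1)) ^ S.card := by
          rw [mul_comm, pow_mul]
  rw [div_eq_mul_inv, mul_pow, ← ENNReal.inv_pow, ← div_eq_mul_inv, ENNReal.le_div_iff_mul_le (Or.inl hpow0) (Or.inl hpowtop)]
  exact h'

/-! ## §2 The socket's weight binder from one level-uniform (H_K) letter -/

/-- ★★★ **(hw-DISCHARGE, GENERIC) THE SOCKET'S WEIGHT BINDER FROM ONE LEVEL-UNIFORM (H_K) LETTER**: hybrid trajectories `V s` of the socket ✓p760591 for a small-loop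
average `ℰ` (radius `δ`) on any group with the lit carrier instances; standing range `j + n ≤ m + K`; a constant `K ∈ [1, ∞)` with the (H_K) letter at EVERY in-range level
(`hfib`, the shape of ✓`fibre_law_le_su2` ∕ ✓`fibre_law_le_explicit`); any `δ′` with `h(δ′) ≠ 0`.  Then
`dU_j((⋂_{τ∈s} {Small ℰ (V s′ τ.1 ·) τ.2}) ∩ (V s′ n)⁻¹B) ≤ (K · h(δ+δ′)^{L^{d−1}−1} ∕ h(δ′))^{|s|} · dU_{j+n}(B)`. [cite: Balaban1987RG1, (0.4) p.253; Balaban1985UV3, (2) p.256] -/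
theorem hw_of_fibre_law {G : Type*} [GaugeGroup G] [MeasurableSpace G] [RegularGaugeGroup G] [HaarData G] (ℰ : LoopAverage G)
    (hE : ∀ m, Measurable fun W : Fin (m + 1) → G => ℰ.E W) (n : ℕ)
    (V : Finset (Σ i : Fin n, PBond P (j + i + 1)) → (i : ℕ) → GaugeField P j G → GaugeField P (j + i) G)
    (hV0 : ∀ s U, V s 0 U = U)
    (hVs : ∀ s (i : ℕ) (hi : i < n) U, V s (i + 1) U = fun c =>
      if c ∈ (Finset.univ.filter fun c' => (⟨⟨i, hi⟩, c'⟩ : Σ i : Fin n, PBond P (j + i + 1)) ∈ s) then avgFun ℰ (V s i U) c else axialAvg (V s i U) c)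
    (hn : j + n ≤ P.m + P.K) {K : ℝ≥0∞} (hK1 : 1 ≤ K) (hKtop : K ≠ ∞)
    (hfib : ∀ k : ℕ, k + 1 ≤ P.m + P.K → ∀ (c : PBond P (k + 1)) (U : GaugeField P k G), (∃ g : G, Small ℰ (update U (centralBond c) g) c) →
      (HaarData.haar : Measure G).map (fun g => avgFun ℰ (update U (centralBond c) g) c) ≤ K • (HaarData.haar : Measure G))
    (δ' : ℝ) (hh0 : (HaarData.haar : Measure G) {g : G | dist1 g < δ'} ≠ 0) :
    ∀ s s' : Finset (Σ i : Fin n, PBond P (j + i + 1)), s' ⊆ s → ∀ B : Set (GaugeField P (j + n) G), MeasurableSet B →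
      fieldMeasure P j G ((⋂ τ ∈ s, {U : GaugeField P j G | Small ℰ (V s' τ.1 U) τ.2}) ∩ V s' n ⁻¹' B) ≤
        (K * ((HaarData.haar : Measure G) {g : G | dist1 g < ℰ.δ + δ'} ^ (P.L ^ (P.d - 1) - 1) / (HaarData.haar : Measure G) {g : G | dist1 g < δ'})) ^ s.card *
          fieldMeasure P (j + n) G B :=
  hw_of_stackedActivity ℰ n V hE hV0 hVs hn hK1 hKtop (fun i hi c U hadm => hfib (j + i) (by omega) c U hadm) _
    (fun i hi S => admitting_le_pow_div ℰ (by omega) δ' hh0 S)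

/-! ## §3 Finiteness letters for the assembler's `ofReal` ∕ `toReal` bridge (px8 g13's request): every displayed constant is `≠ ∞` (and `K ≥ 1`) -/

/-- The window ratio `h(r)^M ∕ h(δ′)` is finite as soon as `h(δ′) ≠ 0` (Haar is a probability measure). [folklore] -/
theorem window_ratio_ne_top {G : Type*} [GaugeGroup G] [MeasurableSpace G] [RegularGaugeGroup G] [HaarData G] (r δ' : ℝ) (M : ℕ)
    (hh0 : (HaarData.haar : Measure G) {g : G | dist1 g < δ'} ≠ 0) :
    (HaarData.haar : Measure G) {g : G | dist1 g < r} ^ M / (HaarData.haar : Measure G) {g : G | dist1 g < δ'} ≠ ∞ := by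
  haveI := HaarData.isProb (G := G)
  exact (ENNReal.div_lt_top (ENNReal.pow_ne_top (measure_ne_top _ _)) hh0).ne

/-- The window ratio is at most `1 ∕ h(δ′)`, in particular its `toReal` is the real ratio: `(h(r)^M ∕ h(δ′)).toReal = (h(r)).toReal^M ∕ (h(δ′)).toReal`. [folklore] -/
theorem toReal_window_ratio {G : Type*} [GaugeGroup G] [MeasurableSpace G] [RegularGaugeGroup G] [HaarData G] (r δ' : ℝ) (M : ℕ) :
    ((HaarData.haar : Measure G) {g : G | dist1 g < r} ^ M / (HaarData.haar : Measure G) {g : G | dist1 g < δ'}).toReal =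
      ((HaarData.haar : Measure G) {g : G | dist1 g < r}).toReal ^ M / ((HaarData.haar : Measure G) {g : G | dist1 g < δ'}).toReal := by
  rw [ENNReal.toReal_div, ENNReal.toReal_pow]

/-- `1 ≤ K⋆` and `K⋆ ≠ ∞` for the (H_K) constant of ✓`fibre_law_le_su2` (`L^{d−1} ≤ 9`). [folklore] -/
theorem one_le_kstar_nine_and_ne_top :
    (1 : ℝ≥0∞) ≤ (ENNReal.ofReal (((1 / 9 : ℝ) * Real.sin 1 * (Real.sin (Real.pi / 3) / (Real.pi / 3))) ^ 3 * (Real.sin (Real.pi / 3) / (Real.pi / 3)) ^ 2))⁻¹ + 1 ∧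
    (ENNReal.ofReal (((1 / 9 : ℝ) * Real.sin 1 * (Real.sin (Real.pi / 3) / (Real.pi / 3))) ^ 3 * (Real.sin (Real.pi / 3) / (Real.pi / 3)) ^ 2))⁻¹ + 1 ≠ ∞ :=
  ⟨le_add_self, ENNReal.add_ne_top.2 ⟨ENNReal.inv_ne_top.2 (ENNReal.ofReal_pos.2 mstar_pos).ne', ENNReal.one_ne_top⟩⟩

/-- `1 ≤ K⋆⋆` and `K⋆⋆ ≠ ∞` for the (H_K) constant of ✓`fibre_law_le_su2_wide` (`L^{d−1} ≤ 25`). [folklore] -/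
theorem one_le_kstar_twentyfive_and_ne_top :
    (1 : ℝ≥0∞) ≤ (ENNReal.ofReal (((1 / 25 : ℝ) * Real.sin 1 * (Real.sin (Real.pi / 3) / (Real.pi / 3))) ^ 3 * (Real.sin (Real.pi / 3) / (Real.pi / 3)) ^ 2))⁻¹ + 1 ∧
    (ENNReal.ofReal (((1 / 25 : ℝ) * Real.sin 1 * (Real.sin (Real.pi / 3) / (Real.pi / 3))) ^ 3 * (Real.sin (Real.pi / 3) / (Real.pi / 3)) ^ 2))⁻¹ + 1 ≠ ∞ :=
  ⟨le_add_self, ENNReal.add_ne_top.2 ⟨ENNReal.inv_ne_top.2 (ENNReal.ofReal_pos.2 mstar_wide_pos).ne', ENNReal.one_ne_top⟩⟩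

/-- `1 ≤ K_rec` and `K_rec ≠ ∞` for the (H_K) constant of ✓`fibre_law_le_su2_record` (`L^{d−1} ≤ 400`). [folklore] -/
theorem one_le_kstar_four_hundred_and_ne_top :
    (1 : ℝ≥0∞) ≤ (ENNReal.ofReal (((1 / 400 : ℝ) * Real.sin 1 * (Real.sin (Real.pi / 3) / (Real.pi / 3))) ^ 3 * (Real.sin (Real.pi / 3) / (Real.pi / 3)) ^ 2))⁻¹ + 1 ∧
    (ENNReal.ofReal (((1 / 400 : ℝ) * Real.sin 1 * (Real.sin (Real.pi / 3) / (Real.pi / 3))) ^ 3 * (Real.sin (Real.pi / 3) / (Real.pi / 3)) ^ 2))⁻¹ + 1 ≠ ∞ :=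
  ⟨le_add_self, ENNReal.add_ne_top.2 ⟨ENNReal.inv_ne_top.2 (ENNReal.ofReal_pos.2 mstar_record_pos).ne', ENNReal.one_ne_top⟩⟩

/-- The socket weight base `K · (h(r)^M ∕ h(δ′))` is finite for every finite `K` once `h(δ′) ≠ 0` — so `w s = (K·q)^{|s|} = ENNReal.ofReal ((K·q).toReal ^ |s|)`
(`ENNReal.ofReal_toReal`, `ENNReal.toReal_pow`) for the assembler's passage to the real count. [folklore] -/
theorem weight_base_ne_top {G : Type*} [GaugeGroup G] [MeasurableSpace G] [RegularGaugeGroup G] [HaarData G] {K : ℝ≥0∞} (hKtop : K ≠ ∞) (r δ' : ℝ) (M : ℕ)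
    (hh0 : (HaarData.haar : Measure G) {g : G | dist1 g < δ'} ≠ 0) :
    K * ((HaarData.haar : Measure G) {g : G | dist1 g < r} ^ M / (HaarData.haar : Measure G) {g : G | dist1 g < δ'}) ≠ ∞ :=
  ENNReal.mul_ne_top hKtop (window_ratio_ne_top r δ' M hh0)

/-- The weight as an `ofReal` of a real power: `(K·q)^{|s|} = ENNReal.ofReal ((K·q).toReal ^ k)` for finite `K·q`. [folklore] -/
theorem weight_pow_eq_ofReal {x : ℝ≥0∞} (hx : x ≠ ∞) (k : ℕ) : x ^ k = ENNReal.ofReal (x.toReal ^ k) := by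
  rw [← ENNReal.toReal_pow, ENNReal.ofReal_toReal (ENNReal.pow_ne_top hx)]

/-! ## §4 Hypothesis-free at print's exp-mean-log average -/

/-- ★★★ **(hw-DISCHARGE AT `SU(2)`, `L^{d−1} ≤ 9` — the T³ families at `L = 3`)**: for the socket's hybrid trajectories built with print's exp-mean-log average on `SU(2)`
(guard radius `1∕3`), standing range, `L^{d−1} ≤ 9`, any `δ′` with `h(δ′) ≠ 0`:
`dU_j((⋂_{τ∈s} {Small (V s′ τ.1 ·) τ.2}) ∩ (V s′ n)⁻¹B) ≤ (K⋆ · h(1∕3+δ′)^{L^{d−1}−1} ∕ h(δ′))^{|s|} · dU_{j+n}(B)` with `K⋆ = m⋆⁻¹ + 1`,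
`m⋆ = ((1∕9)·sin 1·(sin(π∕3)∕(π∕3)))³·(sin(π∕3)∕(π∕3))²` — (H_K) by ✓`fibre_law_le_su2` ∘ ✓`card_not_central_div_le`, NO hypothesis left but the range and `h(δ′) ≠ 0`
(✓`…GuardHaarBallLower` at `δ′ ≤ 1`). [cite: Balaban1987RG1, (0.4) p.253; Balaban1985UV3, (2) p.256] -/
theorem hw_su2_of_pow_le_nine (n : ℕ)
    (V : Finset (Σ i : Fin n, PBond P (j + i + 1)) → (i : ℕ) → GaugeField P j (Matrix.specialUnitaryGroup (Fin 2) ℂ) →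
      GaugeField P (j + i) (Matrix.specialUnitaryGroup (Fin 2) ℂ))
    (hV0 : ∀ s U, V s 0 U = U)
    (hVs : ∀ s (i : ℕ) (hi : i < n) U, V s (i + 1) U = fun c =>
      if c ∈ (Finset.univ.filter fun c' => (⟨⟨i, hi⟩, c'⟩ : Σ i : Fin n, PBond P (j + i + 1)) ∈ s) then
        avgFun (expMeanLogSU : LoopAverage (Matrix.specialUnitaryGroup (Fin 2) ℂ)) (V s i U) c else axialAvg (V s i U) c)
    (hn : j + n ≤ P.m + P.K) (hL : P.L ^ (P.d - 1) ≤ 9)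
    (δ' : ℝ) (hh0 : (HaarData.haar : Measure (Matrix.specialUnitaryGroup (Fin 2) ℂ)) {g | dist1 g < δ'} ≠ 0) :
    ∀ s s' : Finset (Σ i : Fin n, PBond P (j + i + 1)), s' ⊆ s → ∀ B : Set (GaugeField P (j + n) (Matrix.specialUnitaryGroup (Fin 2) ℂ)), MeasurableSet B →
      fieldMeasure P j (Matrix.specialUnitaryGroup (Fin 2) ℂ)
          ((⋂ τ ∈ s, {U | Small (expMeanLogSU : LoopAverage (Matrix.specialUnitaryGroup (Fin 2) ℂ)) (V s' τ.1 U) τ.2}) ∩ V s' n ⁻¹' B) ≤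
        (((ENNReal.ofReal (((1 / 9 : ℝ) * Real.sin 1 * (Real.sin (Real.pi / 3) / (Real.pi / 3))) ^ 3 * (Real.sin (Real.pi / 3) / (Real.pi / 3)) ^ 2))⁻¹ + 1) *
            ((HaarData.haar : Measure (Matrix.specialUnitaryGroup (Fin 2) ℂ)) {g | dist1 g < 1 / 3 + δ'} ^ (P.L ^ (P.d - 1) - 1) /
              (HaarData.haar : Measure (Matrix.specialUnitaryGroup (Fin 2) ℂ)) {g | dist1 g < δ'})) ^ s.card *
          fieldMeasure P (j + n) (Matrix.specialUnitaryGroup (Fin 2) ℂ) B := by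
  obtain ⟨hK1, hKtop⟩ := one_le_kstar_nine_and_ne_top
  have h := hw_of_fibre_law (expMeanLogSU : LoopAverage (Matrix.specialUnitaryGroup (Fin 2) ℂ)) measurable_expMeanLogSU_E n V hV0 hVs hn hK1 hKtop
    (fun k hk c U hadm => fibre_law_le_su2 hk (fun c' => card_not_central_div_le c' hL) c U hadm) δ' hh0
  have hδ : (expMeanLogSU : LoopAverage (Matrix.specialUnitaryGroup (Fin 2) ℂ)).δ = 1 / 3 := by
    rw [expMeanLogSU_δ, Fintype.card_fin]
    refine min_eq_left ?_
    have hπ := Real.pi_gt_three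
    push_cast
    linarith
  rw [hδ] at h
  exact h

/-- ★★ **(hw-DISCHARGE AT `SU(2)`, WIDE RANGE `L^{d−1} ≤ 25` — the T³ families at `L ∈ {3, 4, 5}`)**: same as `hw_su2_of_pow_le_nine` with n08-w3's wide (H_K)
✓`fibre_law_le_su2_wide` ∘ ✓`card_not_central_div_le_wide`: `K⋆⋆ = m⋆⋆⁻¹ + 1`, `m⋆⋆ = ((1∕25)·sin 1·(sin(π∕3)∕(π∕3)))³·(sin(π∕3)∕(π∕3))²` (px13 g14 FINDING #60: `≈ 6.8·10⁴`;
the record row `L^{d−1} ≤ 400` of ✓`…SU2Record` has `K_rec ≈ 2.8·10⁸`, numerically useless at `L = 3`, and is not instantiated here). [cite: Balaban1987RG1, (0.4) p.253; Balaban1985UV3, (2) p.256] -/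
theorem hw_su2_of_pow_le_twentyfive (n : ℕ)
    (V : Finset (Σ i : Fin n, PBond P (j + i + 1)) → (i : ℕ) → GaugeField P j (Matrix.specialUnitaryGroup (Fin 2) ℂ) →
      GaugeField P (j + i) (Matrix.specialUnitaryGroup (Fin 2) ℂ))
    (hV0 : ∀ s U, V s 0 U = U)
    (hVs : ∀ s (i : ℕ) (hi : i < n) U, V s (i + 1) U = fun c =>
      if c ∈ (Finset.univ.filter fun c' => (⟨⟨i, hi⟩, c'⟩ : Σ i : Fin n, PBond P (j + i + 1)) ∈ s) then
        avgFun (expMeanLogSU : LoopAverage (Matrix.specialUnitaryGroup (Fin 2) ℂ)) (V s i U) c else axialAvg (V s i U) c)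
    (hn : j + n ≤ P.m + P.K) (hL : P.L ^ (P.d - 1) ≤ 25)
    (δ' : ℝ) (hh0 : (HaarData.haar : Measure (Matrix.specialUnitaryGroup (Fin 2) ℂ)) {g | dist1 g < δ'} ≠ 0) :
    ∀ s s' : Finset (Σ i : Fin n, PBond P (j + i + 1)), s' ⊆ s → ∀ B : Set (GaugeField P (j + n) (Matrix.specialUnitaryGroup (Fin 2) ℂ)), MeasurableSet B →
      fieldMeasure P j (Matrix.specialUnitaryGroup (Fin 2) ℂ)
          ((⋂ τ ∈ s, {U | Small (expMeanLogSU : LoopAverage (Matrix.specialUnitaryGroup (Fin 2) ℂ)) (V s' τ.1 U) τ.2}) ∩ V s' n ⁻¹' B) ≤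
        (((ENNReal.ofReal (((1 / 25 : ℝ) * Real.sin 1 * (Real.sin (Real.pi / 3) / (Real.pi / 3))) ^ 3 * (Real.sin (Real.pi / 3) / (Real.pi / 3)) ^ 2))⁻¹ + 1) *
            ((HaarData.haar : Measure (Matrix.specialUnitaryGroup (Fin 2) ℂ)) {g | dist1 g < 1 / 3 + δ'} ^ (P.L ^ (P.d - 1) - 1) /
              (HaarData.haar : Measure (Matrix.specialUnitaryGroup (Fin 2) ℂ)) {g | dist1 g < δ'})) ^ s.card *
          fieldMeasure P (j + n) (Matrix.specialUnitaryGroup (Fin 2) ℂ) B := by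
  obtain ⟨hK1, hKtop⟩ := one_le_kstar_twentyfive_and_ne_top
  have h := hw_of_fibre_law (expMeanLogSU : LoopAverage (Matrix.specialUnitaryGroup (Fin 2) ℂ)) measurable_expMeanLogSU_E n V hV0 hVs hn hK1 hKtop
    (fun k hk c U hadm => fibre_law_le_su2_wide hk (fun c' => card_not_central_div_le_wide c' hL) c U hadm) δ' hh0
  have hδ : (expMeanLogSU : LoopAverage (Matrix.specialUnitaryGroup (Fin 2) ℂ)).δ = 1 / 3 := by
    rw [expMeanLogSU_δ, Fintype.card_fin]
    refine min_eq_left ?_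
    have hπ := Real.pi_gt_three
    push_cast
    linarith
  rw [hδ] at h
  exact h

/-- ★★ **(hw-DISCHARGE AT `SU(2)`, RECORD RANGE `L^{d−1} ≤ 400` — the T³ families at `L ≤ 20`)**: same with dag-n08-d's record (H_K) ✓`fibre_law_le_su2_record` ∘
✓`card_not_central_div_le_record`: `K_rec = m_rec⁻¹ + 1`, `m_rec = ((1∕400)·sin 1·(sin(π∕3)∕(π∕3)))³·(sin(π∕3)∕(π∕3))²` (px13 g14 FINDING #60: `≈ 2.8·10⁸` — useless at `L = 3`,
where `hw_su2_of_pow_le_nine` is the row; meant for the larger block sizes, where `q = h(1∕3+δ′)^{L^{d−1}−1} ∕ h(δ′)` is smaller by the exponent).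
[cite: Balaban1987RG1, (0.4) p.253; Balaban1985UV3, (2) p.256] -/
theorem hw_su2_of_pow_le_four_hundred (n : ℕ)
    (V : Finset (Σ i : Fin n, PBond P (j + i + 1)) → (i : ℕ) → GaugeField P j (Matrix.specialUnitaryGroup (Fin 2) ℂ) →
      GaugeField P (j + i) (Matrix.specialUnitaryGroup (Fin 2) ℂ))
    (hV0 : ∀ s U, V s 0 U = U)
    (hVs : ∀ s (i : ℕ) (hi : i < n) U, V s (i + 1) U = fun c =>
      if c ∈ (Finset.univ.filter fun c' => (⟨⟨i, hi⟩, c'⟩ : Σ i : Fin n, PBond P (j + i + 1)) ∈ s) then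
        avgFun (expMeanLogSU : LoopAverage (Matrix.specialUnitaryGroup (Fin 2) ℂ)) (V s i U) c else axialAvg (V s i U) c)
    (hn : j + n ≤ P.m + P.K) (hL : P.L ^ (P.d - 1) ≤ 400)
    (δ' : ℝ) (hh0 : (HaarData.haar : Measure (Matrix.specialUnitaryGroup (Fin 2) ℂ)) {g | dist1 g < δ'} ≠ 0) :
    ∀ s s' : Finset (Σ i : Fin n, PBond P (j + i + 1)), s' ⊆ s → ∀ B : Set (GaugeField P (j + n) (Matrix.specialUnitaryGroup (Fin 2) ℂ)), MeasurableSet B →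
      fieldMeasure P j (Matrix.specialUnitaryGroup (Fin 2) ℂ)
          ((⋂ τ ∈ s, {U | Small (expMeanLogSU : LoopAverage (Matrix.specialUnitaryGroup (Fin 2) ℂ)) (V s' τ.1 U) τ.2}) ∩ V s' n ⁻¹' B) ≤
        (((ENNReal.ofReal (((1 / 400 : ℝ) * Real.sin 1 * (Real.sin (Real.pi / 3) / (Real.pi / 3))) ^ 3 * (Real.sin (Real.pi / 3) / (Real.pi / 3)) ^ 2))⁻¹ + 1) *
            ((HaarData.haar : Measure (Matrix.specialUnitaryGroup (Fin 2) ℂ)) {g | dist1 g < 1 / 3 + δ'} ^ (P.L ^ (P.d - 1) - 1) /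
              (HaarData.haar : Measure (Matrix.specialUnitaryGroup (Fin 2) ℂ)) {g | dist1 g < δ'})) ^ s.card *
          fieldMeasure P (j + n) (Matrix.specialUnitaryGroup (Fin 2) ℂ) B := by
  obtain ⟨hK1, hKtop⟩ := one_le_kstar_four_hundred_and_ne_top
  have h := hw_of_fibre_law (expMeanLogSU : LoopAverage (Matrix.specialUnitaryGroup (Fin 2) ℂ)) measurable_expMeanLogSU_E n V hV0 hVs hn hK1 hKtop
    (fun k hk c U hadm => fibre_law_le_su2_record hk (fun c' => card_not_central_div_le_record c' hL) c U hadm) δ' hh0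
  have hδ : (expMeanLogSU : LoopAverage (Matrix.specialUnitaryGroup (Fin 2) ℂ)).δ = 1 / 3 := by
    rw [expMeanLogSU_δ, Fintype.card_fin]
    refine min_eq_left ?_
    have hπ := Real.pi_gt_three
    push_cast
    linarith
  rw [hδ] at h
  exact h

/-- **(hw-DISCHARGE AT `SU(N)` ON SMALL LOOP-INDEX SETS `|Idx| ≤ 300`)** (n08-w6's explicit (H_K) — NOT the T³ families, whose `|Idx| = L^d·(d!)² = 36L³ ≥ 972` at `d = 3`, `L ≥ 3`,
px13 g14 FINDING #60; kept for the `N`-generic bookkeeping on small loop-index sets): `w s = (K_N·q)^{|s|}`, `K_N = ((1∕|Idx|)^{N²−1})⁻¹ + 1`, `q = h(δ_N+δ′)^{L^{d−1}−1} ∕ h(δ′)`, `δ_N = min(1∕3, π∕N)`.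
[cite: Balaban1987RG1, (0.4) p.253; Balaban1985UV3, (2) p.256] -/
theorem hw_expMeanLogSU (n : ℕ)
    (V : Finset (Σ i : Fin n, PBond P (j + i + 1)) → (i : ℕ) → GaugeField P j (Matrix.specialUnitaryGroup (Fin N) ℂ) →
      GaugeField P (j + i) (Matrix.specialUnitaryGroup (Fin N) ℂ))
    (hV0 : ∀ s U, V s 0 U = U)
    (hVs : ∀ s (i : ℕ) (hi : i < n) U, V s (i + 1) U = fun c =>
      if c ∈ (Finset.univ.filter fun c' => (⟨⟨i, hi⟩, c'⟩ : Σ i : Fin n, PBond P (j + i + 1)) ∈ s) then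
        avgFun (expMeanLogSU : LoopAverage (Matrix.specialUnitaryGroup (Fin N) ℂ)) (V s i U) c else axialAvg (V s i U) c)
    (hn : j + n ≤ P.m + P.K) (hI : Fintype.card (Idx P) ≤ 300) (hI0 : 0 < Fintype.card (Idx P))
    (δ' : ℝ) (hh0 : (HaarData.haar : Measure (Matrix.specialUnitaryGroup (Fin N) ℂ)) {g | dist1 g < δ'} ≠ 0) :
    ∀ s s' : Finset (Σ i : Fin n, PBond P (j + i + 1)), s' ⊆ s → ∀ B : Set (GaugeField P (j + n) (Matrix.specialUnitaryGroup (Fin N) ℂ)), MeasurableSet B →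
      fieldMeasure P j (Matrix.specialUnitaryGroup (Fin N) ℂ)
          ((⋂ τ ∈ s, {U | Small (expMeanLogSU : LoopAverage (Matrix.specialUnitaryGroup (Fin N) ℂ)) (V s' τ.1 U) τ.2}) ∩ V s' n ⁻¹' B) ≤
        (((ENNReal.ofReal (((Fintype.card (Idx P) : ℝ))⁻¹ ^ (N ^ 2 - 1)))⁻¹ + 1) *
            ((HaarData.haar : Measure (Matrix.specialUnitaryGroup (Fin N) ℂ)) {g | dist1 g < min (1 / 3) (Real.pi / N) + δ'} ^ (P.L ^ (P.d - 1) - 1) /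
              (HaarData.haar : Measure (Matrix.specialUnitaryGroup (Fin N) ℂ)) {g | dist1 g < δ'})) ^ s.card *
          fieldMeasure P (j + n) (Matrix.specialUnitaryGroup (Fin N) ℂ) B := by
  have hK1 : (1 : ℝ≥0∞) ≤ (ENNReal.ofReal (((Fintype.card (Idx P) : ℝ))⁻¹ ^ (N ^ 2 - 1)))⁻¹ + 1 := le_add_self
  have hKtop : (ENNReal.ofReal (((Fintype.card (Idx P) : ℝ))⁻¹ ^ (N ^ 2 - 1)))⁻¹ + 1 ≠ ∞ := by
    refine ENNReal.add_ne_top.2 ⟨ENNReal.inv_ne_top.2 ?_, ENNReal.one_ne_top⟩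
    have hpos : (0 : ℝ) < ((Fintype.card (Idx P) : ℝ))⁻¹ ^ (N ^ 2 - 1) := pow_pos (inv_pos.2 (by exact_mod_cast hI0)) _
    exact (ENNReal.ofReal_pos.2 hpos).ne'
  have h := hw_of_fibre_law (expMeanLogSU : LoopAverage (Matrix.specialUnitaryGroup (Fin N) ℂ)) measurable_expMeanLogSU_E n V hV0 hVs hn hK1 hKtop
    (fun k hk c U hadm => fibre_law_le_explicit hI hk c U hadm) δ' hh0
  rw [expMeanLogSU_δ, Fintype.card_fin] at h
  exact h

end Summit.QuantumFields.YangMills.Theorems.UV3BranchExpansionSocketWeightsSU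

end
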